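import Literature.NumberTheory.LFunctions.ConreyIwaniec2002Corollary63Large
import Literature.NumberTheory.LFunctions.ConreyIwaniec2002LOneTrivialLowerBound
import Literature.NumberTheory.LFunctions.ConreyIwaniec2002IdealNormCount
import Literature.NumberTheory.LFunctions.ConreyIwaniec2002MeanValueDefs
import Literature.NumberTheory.LFunctions.ConreyIwaniec2002Prop64Absorb
import Literature.NumberTheory.LFunctions.ConreyIwaniec2002Kernel
import Literature.NumberTheory.LFunctions.ConreyIwaniec2002OffDiagonal
import Literature.NumberTheory.LFunctions.ConreyIwaniec2002Thm61Assembly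
import Literature.Barriers.Parity.SiegelZeroPrimePairsProofs
import HarnessLib

/-!
# Conrey–Iwaniec (2002), Proposition 6.4 from its two remaining printed inputs (the composition of SKELETON P64)

B. Conrey, H. Iwaniec, *Spacing of zeros of Hecke L-functions and the class number problem*, Acta
Arith. 103 (2002) 259–312, §6, Proposition 6.4 (6.37)–(6.52) [held text `paper:arxiv-math_0111012`,
p0014–p0017]. This file is the KERNEL COMPOSITION of the line `thm61-cm-convolution` (cell
landau-siegel/ls-inputs, SKELETON P64 v7): the typed deep hypothesis
`conreyIwaniec2002_proposition64` follows from
* (S2a) the generic mean-value evaluation (6.4)–(6.12) (`∃ c > 0, Thm61Generic c`),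
* (S2b) the shifted-sum evaluation (6.27)–(6.28) (`∃ c > 0, Thm61ShiftedSum c`),
* (S3) Theorems 4.3–4.4: the shifted-convolution asymptotics for the class-group forms of `ℚ(√−q)`,
* (S4) the diagonal (6.51) from Corollary 6.3,
together with the LANDED steps S1 (`exists_admissible_kernel`), S2c (`thm61_assembly`), S5
(`offdiagonal_genus_bound`), S6 (`prop64_absorb`), (6.42) and `π/√q ≤ L(1,χ)`. The four hypotheses
are the registered stub statements S2a, S2b, S3, S4 of the skeleton, verbatim.

PROVED HERE: `ConreyIwaniec2002.proposition64_of_stubs` (plus `ciL_zero_nonneg`,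
`norm_twistCount_le_divisorSumChar`). No claim about Landau–Siegel zeros is made: Proposition 6.4
itself still rests on S2a, S2b, S3, S4.

## References
* [ConreyIwaniec2002] B. Conrey, H. Iwaniec, Acta Arith. 103 (2002) 259–312: Proposition 6.4
  (6.37)–(6.52); Theorem 6.1; Theorems 4.3–4.4; Corollary 6.3.
-/

noncomputable section

open scoped NumberField
open Complex MeasureTheory

namespace Literature.NumberTheory.LFunctions

namespace ConreyIwaniec2002

open NumberField Literature.NumberTheory.LFunctions.NumberField

/-- `L(0) = 2∫₀^∞ K ≥ 0` for a non-negative kernel. [cite: ConreyIwaniec2002, §6 (6.6)] -/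
theorem ciL_zero_nonneg {K : ℝ → ℝ} (hK : ∀ u, 0 ≤ K u) : 0 ≤ ciL K 0 := by
  unfold ciL
  refine mul_nonneg (by norm_num) (setIntegral_nonneg measurableSet_Ioi fun u _ => ?_)
  simp only [mul_zero, Real.cos_zero, mul_one]
  exact hK u

/-- **(6.42) `|λ_ψ(n)| ≤ τ(n,χ) ≤ τ(n)`** for the class group character `ψ` of the imaginary
quadratic field of discriminant `−q` (KERNEL: `norm_twistCount_le`,
`idealNormCount_eq_norm_divisorSumChar_of_quadratic`, `norm_divisorSumChar_le`).
[cite: ConreyIwaniec2002, §6 (6.42)] -/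
theorem norm_twistCount_le_divisorSumChar {q : ℕ} [NeZero q] {χ : DirichletCharacter ℂ q}
    (hprim : χ.IsPrimitive) (hquad : χ.IsQuadratic) (hodd : χ.Odd)
    (K : Type) [Field K] [NumberField K] (h2 : Module.finrank ℚ K = 2)
    (hdisc : NumberField.discr K = -(q : ℤ)) (ψ : ClassGroup (𝓞 K) →* ℂˣ) (n : ℕ) :
    ‖twistCount K (classGroupCharIdealHom ψ) n‖ ≤ ‖divisorSumChar χ n‖ := by
  rcases Nat.eq_zero_or_pos n with hn | hn
  · subst hn; simp [twistCount_zero]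
  · calc ‖twistCount K (classGroupCharIdealHom ψ) n‖ ≤ (idealNormCount K n : ℝ) :=
          norm_twistCount_le (norm_classGroupCharIdealHom_le ψ) n
      _ = ‖divisorSumChar χ n‖ :=
          idealNormCount_eq_norm_divisorSumChar_of_quadratic hprim hquad hodd K h2 hdisc hn.ne'

/-- **Proposition 6.4 from S2a, S2b, S3, S4** — the kernel composition of SKELETON P64: with the
landed S1 (`exists_admissible_kernel`), S2c (`thm61_assembly`), S5 (`offdiagonal_genus_bound`), S6
(`prop64_absorb`), (6.42) and `π/√q ≤ L(1,χ)`, the four registered stub statements imply the TYPED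
`conreyIwaniec2002_proposition64` by name. [cite: ConreyIwaniec2002, Proposition 6.4 (6.52)] -/
theorem proposition64_of_stubs
    (h2a : ∃ c : ℝ, 0 < c ∧ Thm61Generic c) (h2b : ∃ c : ℝ, 0 < c ∧ Thm61ShiftedSum c)
    (h3 :
      ∃ c : ℝ, 0 < c ∧
        ∀ (q : ℕ) [NeZero q], 4 < q → Odd q → ∀ χ : DirichletCharacter ℂ q,
          χ.IsPrimitive → χ.IsQuadratic → χ.Odd →
            ∀ (K : Type) [Field K] [NumberField K],
              Module.finrank ℚ K = 2 → NumberField.discr K = -(q : ℤ) →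
                ∀ (ψ : ClassGroup (𝓞 K) →* ℂˣ),
                  ∃ σ : ℕ → ℝ, IsCISigma q ‖χ.LFunction 1‖ σ ∧
                    ShiftedConvolutionBound (twistCount K (classGroupCharIdealHom ψ)) σ
                      (c * (q : ℝ) ^ (6 : ℕ)))
    (h4 :
      ∃ c : ℝ, 0 < c ∧
        ∀ (q : ℕ) [NeZero q], 4 < q → ∀ χ : DirichletCharacter ℂ q,
          χ.IsPrimitive → χ.IsQuadratic → χ.Odd →
            ∀ (T : ℝ) (a : ℝ → ℂ), (q : ℝ) ^ (3 : ℕ) ≤ T → IsCutoff a T (q * T) →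
              Summable (fun n : ℕ ↦ ‖divisorSumChar χ n‖ ^ 2 * ‖a n‖ ^ 2 / (n : ℝ)) ∧
                ∑' n : ℕ, ‖divisorSumChar χ n‖ ^ 2 * ‖a n‖ ^ 2 / (n : ℝ) ≤
                  c * (calL χ T * Real.log q + Real.sqrt q * T ^ (-(9 / 20 : ℝ)))) :
    conreyIwaniec2002_proposition64 := by
  obtain ⟨Kf, c₀, hKf, hK0, hc₀, hK1⟩ := exists_admissible_kernel
  obtain ⟨ca, hca, ha2⟩ := h2a
  obtain ⟨cb, hcb, hb2⟩ := h2b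
  obtain ⟨c₁, hc₁, h61⟩ := thm61_assembly ca cb hca hcb ha2 hb2
  obtain ⟨c₂, hc₂, hconv⟩ := h3
  obtain ⟨c₃, hc₃, hdiag⟩ := h4
  obtain ⟨c₄, hc₄, hoff⟩ := offdiagonal_genus_bound
  have hL0 : 0 ≤ ciL Kf 0 := ciL_zero_nonneg hK0
  obtain ⟨C, hC, habs⟩ := prop64_absorb (ciL Kf 0) c₁ c₂ c₃ c₄ hL0 hc₁.le hc₂.le hc₃.le hc₄.le
  refine ⟨C / c₀, div_pos hC hc₀, ?_⟩
  intro q _ hq hodd χ hprim hquad hoddχ K _ _ h2 hdisc ψ T a hT ha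
  -- numerics of the range
  have hq5 : (5 : ℝ) ≤ q := by exact_mod_cast hq
  have hq1 : (1 : ℝ) ≤ q := by linarith
  have hqT : (q : ℝ) ≤ T := le_trans (le_self_pow₀ hq1 (by norm_num)) hT
  have hT2 : (2 : ℝ) ≤ T := by linarith
  have hTpos : 0 < T := by linarith
  have hTY : T ≤ q * T := le_mul_of_one_le_left hTpos.le hq1
  have hY8 : (q : ℝ) * T ≤ T ^ (8 : ℕ) := by
    calc (q : ℝ) * T ≤ T * T := mul_le_mul_of_nonneg_right hqT hTpos.le
      _ = T ^ (2 : ℕ) := by ring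
      _ ≤ T ^ (8 : ℕ) := pow_le_pow_right₀ (by linarith) (by norm_num)
  have hq3T : (q : ℝ) ^ (3 : ℕ) ≤ T := le_trans (pow_le_pow_right₀ hq1 (by norm_num)) hT
  -- the data of the line
  set lam : ℕ → ℂ := twistCount K (classGroupCharIdealHom ψ) with hlam
  set ℓ : ℝ := ‖χ.LFunction 1‖ with hℓ
  obtain ⟨σ, hσ, hSC⟩ := hconv q hq hodd χ hprim hquad hoddχ K h2 hdisc ψ
  have hlam_le : ∀ n : ℕ, 1 ≤ n → ‖lam n‖ ≤ (Nat.divisors n).card := fun n _ =>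
    (norm_twistCount_le_divisorSumChar hprim hquad hoddχ K h2 hdisc ψ n).trans
      (norm_divisorSumChar_le χ n)
  have hσ_le : ∀ h : ℕ, 1 ≤ h → |σ h| ≤ 2 * ℓ ^ 2 * ∑ d ∈ Nat.divisors h, (d : ℝ)⁻¹ := hσ.1
  have hB₁ : 0 ≤ c₂ * (q : ℝ) ^ (6 : ℕ) := by positivity
  have hC₁ : (0 : ℝ) ≤ 2 * ℓ ^ 2 := by positivity
  -- S2: Theorem 6.1 at `Y = qT`
  have h1 := h61 Kf c₀ hKf hK0 hc₀ hK1 lam σ (c₂ * (q : ℝ) ^ (6 : ℕ)) (2 * ℓ ^ 2) hB₁ hC₁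
    hlam_le hσ_le hSC T (q * T) a hT2 hTY hY8 ha
  -- S4 + (6.42): the diagonal
  obtain ⟨hsum, hG'⟩ := hdiag q hq χ hprim hquad hoddχ T a hq3T ha
  have hG : ∑' n : ℕ, ‖a n * lam n‖ ^ 2 / (n : ℝ) ≤
      c₃ * (calL χ T * Real.log q + Real.sqrt q * T ^ (-(9 / 20 : ℝ))) := by
    have hle : ∀ n : ℕ, ‖a n * lam n‖ ^ 2 / (n : ℝ) ≤
        ‖divisorSumChar χ n‖ ^ 2 * ‖a n‖ ^ 2 / (n : ℝ) := fun n => by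
      have hn0 : (0 : ℝ) ≤ (n : ℝ) := Nat.cast_nonneg n
      rw [norm_mul, mul_pow, mul_comm]
      refine div_le_div_of_nonneg_right ?_ hn0
      exact mul_le_mul_of_nonneg_right
        (pow_le_pow_left₀ (norm_nonneg _)
          (norm_twistCount_le_divisorSumChar hprim hquad hoddχ K h2 hdisc ψ n) 2)
        (sq_nonneg _)
    exact le_trans (Summable.tsum_le_tsum hle
      (hsum.of_nonneg_of_le (fun n => by positivity) hle) hsum) hG'
  -- S5: the off-diagonal (`q` odd with a primitive real character mod `q` ⇒ `q` squarefree, §2)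
  have hsqf : Squarefree q := by
    rw [Nat.squarefree_iff_prime_squarefree]
    intro p hp hpp
    have hp2 : p ≠ 2 := by
      rintro rfl
      exact (Nat.not_even_iff_odd.mpr hodd) (even_iff_two_dvd.mpr ((dvd_mul_right 2 2).trans hpp))
    exact Literature.Barriers.Parity.SiegelCorr.not_odd_prime_sq_dvd χ hprim hquad hp hp2
      (by rw [pow_two]; exact hpp)
  have hD := hoff q hq hsqf ℓ (norm_nonneg _) σ hσ Kf hKf T (q * T) a hT2 hTY le_rfl ha
  have hD' : ∫ y in Set.Ioi (0 : ℝ), ‖a y‖ ^ 2 * ciD Kf σ (T / y) / y ≤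
      c₄ * ℓ ^ 2 * Real.log q ^ 2 := le_trans (le_abs_self _) hD
  -- S6: absorption
  have hℓ_lb : Real.pi / Real.sqrt q ≤ ℓ := pi_div_sqrt_le_norm_LFunction_one hq hprim hquad hoddχ
  have hcalL : ℓ ^ 2 * Real.log T ≤ calL χ T := by
    unfold calL
    have hlogT : 0 ≤ Real.log T := Real.log_nonneg (by linarith)
    have : 0 ≤ ‖deriv χ.LFunction 1‖ := norm_nonneg _
    nlinarith [norm_nonneg (χ.LFunction 1), mul_nonneg (norm_nonneg (χ.LFunction 1)) this]
  have h2 := habs q T ℓ (calL χ T) hq5 hT hℓ_lb hcalL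
  -- assemble
  have hmain : c₀ * ∫ t in T..2 * T, ‖LSeries (fun n ↦ a n * lam n) (1 / 2 + t * I)‖ ^ 2 ≤
      C * (T * calL χ T * Real.log q) := by
    refine le_trans h1 (le_trans ?_ h2)
    have hlogq : 0 ≤ Real.log q := Real.log_nonneg hq1
    gcongr
  rw [div_mul_eq_mul_div, le_div_iff₀ hc₀, mul_comm]
  exact hmain


end ConreyIwaniec2002

end Literature.NumberTheory.LFunctions

end
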